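import Literature.MathematicalPhysics.QuantumFieldTheory.BalabanImbrieJaffe1984to88.BIJ88Eq240FlatTorus

/-!
# `BalabanImbrieJaffe1984to88.BIJ88Decay241FlatTorus` — T. Bałaban, J. Imbrie, A. Jaffe, *Effective action and cluster properties of the
abelian Higgs model*, Commun. Math. Phys. **114** (1988) 257–315 [BalabanImbrieJaffe1988], §2 (2.41) p. 264 [PDF 8]: **THE SINGLE-SCALE
PROPAGATOR `C^{(k)}_Λ(u) = [(Δ_{k,loc}(u) + aL^{−2}Q(u)^*Q(u))|_Λ]^{−1}` DECAYS EXPONENTIALLY, `|C^{(k)}_Λ(u;x₁,x₂)| ≦ ce^{−c|x₁−x₂|}`, AT EVERY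
FLAT / PURE-GAUGE BACKGROUND `u = 1^h` ON THE TORUS** — p. 264 *"by (2.38), C^{(k)}_Λ(u)^{−1} is bounded below and a random walk expansion as in
[6] can be used to prove (2.41)"* made a theorem with its two inputs BY NAME (the p. 264 lower bound at flat `u`: gen 18's `lowerBound_op240_flat`
fed by this seat's (2.38) `ineq238_flat_mult`; the locality (2.36) in level-`k` units: gen 17's `decay236_flat_level`, plus the one-block range of
`Q^*Q`) and, as ENGINE, [6] = [Balaban1983RegularityDecay] Sect. 5 (5.7) AS KERNEL-PROVED IN THE TREE (finite Combes–Thomas: r1-g3's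
`QGQInverse.inverse_decay` + pv09's `B4Sect5Torus.weightedRowSum_le`/`weightedColSum_le` over p38's torus profile `B5Ineq137Torus.rowSum_T_le`),
carried to the complex Hermitian-form operators of the Higgs field by gen 18's REALIFICATION.

statement-level skeleton of published theorems with citation tags; proofs where landed; nothing here is a claim about the Yang–Mills mass gap

PDF held: `paper:balaban1988-cmp114-bij-abelian-higgs-effective-action` (journal page = PDF page + 256; p. 264 = PDF 8 re-read this session from the
×2 render `HOME/lit-balaban-p31/renders/original-p008-x2.png` and the text layer `lit read … --pages 7-9`).

CITATION HEADER (lean-in-tree rule).  lit-balaban cell (HOME `run/shared/lean/pub/lit-balaban/`), Phase 2, seat p31 gen 19 (unit `lit-balaban-p31`,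
literature-prover-lit-balaban-p31-g19-0), free-target protocol G.5-34(d), TAKING line HOME/STATUS.md 2026-08-22T20:34:14Z (stem check: `BIJ88Decay241Walks` =
p02 g3's (2.41) in [6]'s ABSTRACT walk setting — hypotheses = a walk expansion with majorant — only; no TAKING line on (2.41) at flat `u`; courtesy notice
to r18).  Row of `HOME/lit-balaban-r18/ROWS-C2.md` (owner r18, referee ref-5): **C2.Eq2.41** (typed `BIJ88Sect2Statements.Decay` p239939, head p02 g3's
`BIJ88Decay241Walks.abs_C_le_exp` «model instance») — here a LOCATED MEMBER at flat `u` for the concrete torus operators (cells only).  Files USED BY NAME,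
nothing restated: gen 18's `BIJ88Eq240FlatTorus` (`pOp`, `op240`, `c240`, `compress`, `ext0`, `realify`, `cplx`, `dotProduct_realify_mulVec`,
`dotProduct_eq_re`, `lowerBound_op240_flat`, `star_dotProduct_compress`), this seat's `BIJ88Ineq238FlatTorus.ineq238_flat_mult` / `aSeq_ge`, gen 17's
`BIJ88DeltaLocFlatClose235` (`decay236_flat_level`, `norm_qMatT_apply_le`), gen 15's `BIJ88DeltaLoc234Torus` (`qMatT_apply`, `deltaLocT`), p33's
`BIJ85BlockKPoincare.val_blkIter`, p11's/r18 g4's `BIJ85BlockAveragesTorusK` (`blkIter`, `blockK`, `mem_blockK`, `cornerIter`), r1-g3's `QGQInverse`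
(`Coercive`, `inverse_decay`), pv09's `B4Sect5Torus` (`IsPseudoDist`, `SumBound`, `weightC`, `weightedRowSum_le`, `weightedColSum_le`, `ccoord_cast`,
`tdist`), pv23's `B4Sect5Proof.latticeConst(_nonneg)`, p38's `B5Ineq137Torus` (`T`, `T_symm`, `T_self`, `T_triangle`, `rowSum_T_le`, `toT`, `Nv`), pv17's
`B4TorusKernel.MultiPeriod.circAbs_le_abs`, pv07's `B1RG242Torus.α`/`one_lt_cast_L`, `B1.aSeq_pos`/`aSeq_le`.

## The print (verbatim, p. 264)

*"We define C^{(k)}_Λ(u) = [(Δ_{k,loc}(u) + aL^{−2}Q(u)*Q(u))|_Λ]^{−1}. (2.40) This is of course a nonlocal operator, but by (2.38), C^{(k)}_Λ(u)^{−1}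
is bounded below and a random walk expansion as in [6] can be used to prove that |C^{(k)}_Λ(u; x₁, x₂)| ≦ ce^{−c|x₁−x₂|}. (2.41) We shall actually
use a convenient resummation of this expansion."*  — [6] = T. Bałaban, CMP **89** (1983), Sect. 5 Theorem p. 594: *"A ≥ γ₀I, |A(x, x′)| ≤
c₀e^{−δ₀|x−x′|}, x, x′ ∈ Ω. (5.6) Then there exist positive constants c₁, δ₁ such that for arbitrary Λ ⊂ Ω and for C_Λ = A_Λ^{−1} … |C_Λ(x, x′)| ≤
c₁e^{−δ₁|x−x′|}, x, x′ ∈ Λ, (5.7)"*.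

## The mechanism and what is proved (theorems only; 0 definitions; 0 `sorry`; no `Prop`-valued fact; standard axioms)

* §1 THE REALIFICATION IS A RING MORPHISM COMPATIBLE WITH INVERSION: `realify_mul`, `realify_one`, `realify_inv`, `abs_realify_apply_le`
  (`|realify M(p,q)| ≤ ‖M p₁ q₁‖`), `coercive_realify` (Re-coercivity `γΣ‖φ‖² ≤ Re φᴴMφ` ⟹ r1-g3's `Coercive (realify M) γ`), `isUnit_of_re_coercive`;
  **`norm_inv_apply_le`** = [6] (5.7) FOR COMPLEX MATRICES with a coercive Hermitian form over any finite index set with a pseudo-distance `ρ` and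
  lattice-sum profile `K`: `‖M(i,j)‖ ≤ c₀e^{−δ₀ρ}`, `0 ≤ θ ≤ δ₀/4`, `θ·c₀(4/δ₀)·2K(δ₀/2) ≤ γ/2` ⟹ **`‖M⁻¹(i,j)‖ ≤ (4/γ)e^{−θρ(i,j)}`** (pv09's weighted
  sums on `ι × Fin 2`, r1-g3's `inverse_decay` for `realify M`, `(realify M)⁻¹ = realify M⁻¹`, `‖z‖ ≤ |Re z| + |Im z|`).
* §2 TORUS GEOMETRY: `isPseudoDist_T`, `sumBound_T` (p38's profile, uniform in the torus), **`T_le_of_blkIter_eq`** (two points of one `L`-block are at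
  sup distance `≤ L − 1`), `pOp_apply_of_ne` / `norm_pOp_apply_le` (`Q^*Q` vanishes between blocks and is `≤ L^{−2d}`), **`norm_op240_apply_le`**
  (`‖(Δ + κQ^*Q)(x₁,x₂)‖ ≤ (c_Δ + κL^{−2d}e^{δ₀(L−1)})e^{−δ₀|x₁−x₂|}` from `‖Δ(x₁,x₂)‖ ≤ c_Δe^{−δ₀|x₁−x₂|}`).
* §3 **`decay241_flat`** — (2.41) AT FLAT `u` FOR ANY COMPLEX `Δ` on `T^{(k)}` with the (2.38)-SHAPE bound `γΣ_b|u(b)φ(b₊)−φ(b₋)|² − E‖φ‖² ≤ Re φᴴΔφ`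
  on the fields supported in `Λ` (`E < c₀(γ,κ)`, gen 18's flat Poincaré constant; the conclusion shape of `ineq238_flat_mult` and of p29's
  `ineq238_flat_cwt`) and a kernel bound on `Λ × Λ`: for every rate `0 ≤ θ ≤ δ₀/4` with `θ·(c_Δ + κL^{−2d}e^{δ₀(L−1)})(4/δ₀)·2K_d(δ₀/2) ≤ (c₀(γ,κ) − E)/2`,
  **`‖C^{(k)}_Λ(1^{h′};x₁,x₂)‖ ≤ (4/(c₀(γ,κ) − E))·e^{−θ|x₁−x₂|_{T^{(k)}}}`** uniformly in the torus and `Λ` (`re_coercive_compress` = the p. 264 lower bound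
  read on `ℓ²(Λ)`, `sum_norm_sq_ext0`).
* §4 **`decay241_deltaLocT_flat`** — THE LOCATED MEMBER FOR GEN 15's `Δ_{k,loc}(1^h)` with constants chosen BEFORE the instance: for every
  `(d, L, a)`, multiplicity `m`, coefficient `κ̂ > 0` there are `(δ₀, c₁)` (of `ineq238_flat_mult`) and `(δ₁, c₂)` such that under EXACTLY the data
  hypotheses of gen 18's `eq240_deltaLocT_flat` and the (2.35)-error at most HALF the flat Poincaré constant,
  **`‖C^{(k)}_Λ(1^h;x₁,x₂)‖ ≤ (a_k/A)·c₂·e^{−δ₁|x₁−x₂|_{T^{(k)}}}`** for `C^{(k)}_Λ(1^h) = [(Δ_{k,loc}(1^h) + (A/a_k)κ̂Q^*Q)|_Λ]^{−1}`, uniformly in `ε`, the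
  torus, `k`, `Λ`, `h`, the cubes and the radii (`spacing_le_one`, **`one_le_ratio`**: `A/a_k = L^{kd}/(L^kε)² ≥ 1`; `c240_smul`, `c240_mono`); and
  **`decay241_deltaLocT_flat_printed`**: the VERBATIM shape `‖C^{(k)}_Λ(1^h;x₁,x₂)‖ ≤ c₂e^{−δ₁|x₁−x₂|}`.
HONEST SCOPE / DIVERGENCE.  (i) FLAT / PURE-GAUGE BACKGROUNDS ONLY (`u_k = 1^{h′}`), as every member of this seat's flat lane; the (2.32)-smooth `u`
needs the non-flat (2.36)/(2.38) (XL, r18 `C2S14-CLOSURE.md` §5 item 2).  (ii) METHOD: the print's *"random walk expansion as in [6]"* is [6] Sect. 5,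
whose Theorem the tree proves by finite Combes–Thomas and NOT by the printed walk resummation (pv23 `B4Sect5Proof`, pv09 `B4Sect5Torus`, divergence
disclosed there); this file inherits that route — the STATEMENT (2.41) is unchanged, the walk expansion (2.42)–(2.45) itself (needed by §3/§5 of the
paper for the `u`-locality of the pieces) is NOT constructed here for the torus operator (p13/p36/p02's files treat it in [6]'s operator model).  (iii)
Counting normalization of gen 15 (`deltaLocT = (A/a_k)×` printed `Δ_{k,loc}`, `A = α_k(a)L^{kd}`): the printed `aL^{−2}` is `κ̂ = aL^{−2}` and `C` is
`(a_k/A)×` the printed `C^{(k)}_Λ` — whence the factor `(a_k/A) ≤ 1` in §4, dropped in the `_printed` form.  (iv) Two constants `(c₂, δ₁)` for the print's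
one generic `c` (prefactor vs rate; HOME/GAPS.md G-C2-p02-02); constants not optimized (`δ₁ ≤ δ₀/4` with `δ₀` the (2.36) rate).  (v) The margin
hypothesis «(2.35)-error ≤ ½ Poincaré constant» replaces gen 18's strict «<» so that the constants can be chosen before the instance; it holds for the
printed radii `R, R₁ ~ r(e_k)L^k` once `r(e_k)` is large.  (vi) `m² = 0`, window `a₋ = a₊ = a`, `1 ≤ k ≤ K`, `k + 1 ≤ m + K`, `Λ` a union of `L`-blocks.
Imports: gen 18's `BIJ88Eq240FlatTorus` only (→ `BIJ88Ineq238FlatTorus`, `BIJ88DeltaLocFlatClose235`, `B5Ineq137Torus` → `B4Sect5Torus` →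
`B4Sect5Proof` → `QGQInverse`).  Literature + Mathlib only.  Unit `lit-balaban-p31` (literature-prover-lit-balaban-p31-g19-0), 2026-08-22.  NOT summit
progress.
-/

open scoped BigOperators Matrix ComplexConjugate
open Finset Matrix

namespace Literature.MathematicalPhysics.QuantumFieldTheory.BalabanImbrieJaffe1984to88.BIJ88Decay241FlatTorus

open Literature.MathematicalPhysics.QuantumFieldTheory.Balaban1983to89
open BIJ88Sect3Statements (U1 toC)
open BIJ85BlockAveragesTorus BIJ85BlockAveragesTorusK
open BIJ88DeltaLoc234Torus (qMatT qMatT_apply deltaLocT)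
open BIJ88Eq240FlatTorus
open B4Sect5Torus (IsPseudoDist SumBound weightC)
open GaugeField (gaugeAct)

noncomputable section

/-! ## §1 The realification is a ring morphism; decay of the inverse of a Re-coercive, exponentially localised COMPLEX matrix
([6] Sect. 5 (5.7) as kernel-proved in the tree — finite Combes–Thomas — carried to complex operators) -/

section Realify

variable {ι : Type*} [Fintype ι] [DecidableEq ι]

omit [DecidableEq ι] in
/-- kernel: `Re φᴴφ = Σ_i ‖φ_i‖²`. [folklore] -/
private theorem re_star_dotProduct_self (φ : ι → ℂ) : (star φ ⬝ᵥ φ).re = ∑ i, ‖φ i‖ ^ 2 := by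
  simp only [dotProduct, Pi.star_apply, Complex.re_sum]
  refine sum_congr rfl fun i _ => ?_
  rw [Complex.star_def, ← Complex.normSq_eq_conj_mul_self, Complex.ofReal_re, Complex.normSq_eq_norm_sq]

omit [Fintype ι] [DecidableEq ι] in
/-- kernel: the entries of the realification are real or imaginary parts: `|realify M (p,q)| ≤ ‖M p₁ q₁‖`.
[cite: BalabanImbrieJaffe1988, (4.9) p.275] -/
theorem abs_realify_apply_le (M : Matrix ι ι ℂ) (p q : ι × Fin 2) : |realify M p q| ≤ ‖M p.1 q.1‖ := by
  rw [realify, of_apply]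
  split_ifs
  · exact Complex.abs_re_le_norm _
  · rw [abs_neg]; exact Complex.abs_im_le_norm _
  · exact Complex.abs_im_le_norm _
  · exact Complex.abs_re_le_norm _

omit [Fintype ι] [DecidableEq ι] in
/-- kernel: the `(Re, Re)` entry of the realification. [cite: BalabanImbrieJaffe1988, (4.9) p.275] -/
theorem realify_apply_fst (M : Matrix ι ι ℂ) (i k : ι) : realify M (i, 0) (k, 0) = (M i k).re := by
  simp [realify]

omit [Fintype ι] [DecidableEq ι] in
/-- kernel: the `(Im, Re)` entry of the realification. [cite: BalabanImbrieJaffe1988, (4.9) p.275] -/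
theorem realify_apply_snd (M : Matrix ι ι ℂ) (i k : ι) : realify M (i, 1) (k, 0) = (M i k).im := by
  simp [realify]

omit [DecidableEq ι] in
/-- **The realification is multiplicative**: `realify (MN) = realify M · realify N` (complex multiplication in real `2 × 2` blocks).
[cite: BalabanImbrieJaffe1988, (4.9) p.275] -/
theorem realify_mul (M N : Matrix ι ι ℂ) : realify (M * N) = realify M * realify N := by
  ext p q
  obtain ⟨i, a⟩ := p
  obtain ⟨k, b⟩ := q
  rw [mul_apply, Fintype.sum_prod_type]
  simp only [Fin.sum_univ_two, realify, of_apply, mul_apply, Fin.isValue]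
  fin_cases a <;> fin_cases b
  all_goals simp only [Fin.isValue, Fin.zero_eta, Fin.mk_one, ↓reduceIte, one_ne_zero, Complex.re_sum, Complex.im_sum,
    ← Finset.sum_neg_distrib]
  all_goals exact Finset.sum_congr rfl fun j _ => by simp only [Complex.mul_re, Complex.mul_im]; ring

omit [Fintype ι] in
/-- **The realification is unital**: `realify 1 = 1`. [cite: BalabanImbrieJaffe1988, (4.9) p.275] -/
theorem realify_one : realify (1 : Matrix ι ι ℂ) = 1 := by
  ext p q
  obtain ⟨i, a⟩ := p
  obtain ⟨k, b⟩ := q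
  simp only [realify, of_apply, one_apply, Prod.mk.injEq]
  by_cases hik : i = k
  · subst hik
    fin_cases a <;> fin_cases b <;> simp
  · fin_cases a <;> fin_cases b <;> simp [hik]

/-- kernel: a Re-coercive complex matrix (`γΣ‖φ_i‖² ≤ Re φᴴMφ`, `γ > 0`) is injective, hence invertible (*"C^{(k)}_Λ(u)^{−1} is bounded below"* ⟹
`C^{(k)}_Λ(u)` exists; gen 18's `isUnit_compress_of_re_pos` is the compressed form). [cite: BalabanImbrieJaffe1988, (2.40)–(2.41) p.264] -/
theorem isUnit_of_re_coercive {M : Matrix ι ι ℂ} {γ : ℝ} (hγ : 0 < γ)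
    (h : ∀ φ : ι → ℂ, γ * ∑ i, ‖φ i‖ ^ 2 ≤ (star φ ⬝ᵥ (M *ᵥ φ)).re) : IsUnit M := by
  rw [← Matrix.mulVec_injective_iff_isUnit]
  intro v w hvw
  by_contra hne
  have hsub : v - w ≠ 0 := sub_ne_zero.2 hne
  obtain ⟨i, hi⟩ := Function.ne_iff.mp hsub
  have h1 := h (v - w)
  rw [mulVec_sub, hvw, sub_self, dotProduct_zero, Complex.zero_re] at h1
  have hpos : 0 < ∑ j, ‖(v - w) j‖ ^ 2 :=
    lt_of_lt_of_le (pow_pos (norm_pos_iff.mpr hi) 2)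
      (single_le_sum (f := fun j => ‖(v - w) j‖ ^ 2) (fun _ _ => by positivity) (mem_univ i))
  nlinarith

/-- **The realification commutes with inversion** (for invertible `M`): `(realify M)⁻¹ = realify M⁻¹`.
[cite: BalabanImbrieJaffe1988, (4.9) p.275] -/
theorem realify_inv {M : Matrix ι ι ℂ} (hM : IsUnit M) : (realify M)⁻¹ = realify M⁻¹ := by
  have hdet : IsUnit M.det := (Matrix.isUnit_iff_isUnit_det M).1 hM
  exact Matrix.inv_eq_left_inv (by rw [← realify_mul, Matrix.nonsing_inv_mul _ hdet, realify_one])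

omit [DecidableEq ι] in
/-- **Re-coercivity of `M` is coercivity of its realification**: `γΣ‖φ‖² ≤ Re φᴴMφ` for all `φ` gives `γ·vᵀv ≤ vᵀ(realify M)v` for all real
`v` (r1-g3's `QGQInverse.Coercive`). [cite: BalabanImbrieJaffe1988, (4.9) p.275] -/
theorem coercive_realify {M : Matrix ι ι ℂ} {γ : ℝ} (h : ∀ φ : ι → ℂ, γ * ∑ i, ‖φ i‖ ^ 2 ≤ (star φ ⬝ᵥ (M *ᵥ φ)).re) :
    QGQInverse.Coercive (realify M) γ := by
  intro v
  rw [dotProduct_realify_mulVec, dotProduct_eq_re v v, re_star_dotProduct_self]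
  exact h (cplx v)

omit [Fintype ι] [DecidableEq ι] in
/-- kernel: a pseudo-distance on `ι` read on `ι × Fin 2` (two real coordinates per site) is a pseudo-distance. [folklore] -/
private theorem isPseudoDist_prod {ρ : ι → ι → ℝ} (h : IsPseudoDist ρ) : IsPseudoDist (fun p q : ι × Fin 2 => ρ p.1 q.1) :=
  h.comp Prod.fst

omit [DecidableEq ι] in
/-- kernel: the lattice-sum profile doubles on `ι × Fin 2`. [folklore] -/
private theorem sumBound_prod {ρ : ι → ι → ℝ} {K : ℝ → ℝ} (h : SumBound ρ K) :
    SumBound (fun p q : ι × Fin 2 => ρ p.1 q.1) (fun a => 2 * K a) := by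
  intro a ha p
  rw [Fintype.sum_prod_type]
  simp only [Finset.sum_const, Finset.card_univ, Fintype.card_fin, nsmul_eq_mul, Nat.cast_ofNat]
  rw [← Finset.mul_sum]
  exact mul_le_mul_of_nonneg_left (h a ha p.1) (by norm_num)

/-- **DECAY OF THE INVERSE OF A Re-COERCIVE, EXPONENTIALLY LOCALISED COMPLEX MATRIX** — [6] = [Balaban1983RegularityDecay] Sect. 5 (5.7)
(*"A ≥ γ₀I, |A(x,x′)| ≤ c₀e^{−δ₀|x−x′|} ⟹ |C_Λ(x,x′)| ≤ c₁e^{−δ₁|x−x′|}"*) in the generalised typing of pv09's `B4Sect5Torus` (any finite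
index set, pseudo-distance `ρ` with lattice-sum profile `K`), AS KERNEL-PROVED THERE (finite Combes–Thomas, r1-g3's `QGQInverse.inverse_decay`, fed by
`B4Sect5Torus.weightedRowSum_le`/`weightedColSum_le` — NOT the printed random-walk resummation), carried to COMPLEX matrices with a coercive
Hermitian form through gen 18's realification: if `γΣ‖φ‖² ≤ Re φᴴMφ` (`γ > 0`), `‖M(i,j)‖ ≤ c₀e^{−δ₀ρ(i,j)}`, `0 ≤ θ ≤ δ₀/4` and
`θ·c₀(4/δ₀)·2K(δ₀/2) ≤ γ/2`, then `‖M⁻¹(i,j)‖ ≤ (4/γ)e^{−θρ(i,j)}`. [cite: Balaban1983RegularityDecay, Sect. 5 Theorem (5.7) p.594] -/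
theorem norm_inv_apply_le {M : Matrix ι ι ℂ} {ρ : ι → ι → ℝ} (hρ : IsPseudoDist ρ) {K : ℝ → ℝ}
    (hS : SumBound ρ K) {γ c₀ δ₀ θ : ℝ} (hγ : 0 < γ) (hc : 0 ≤ c₀) (hδ : 0 < δ₀)
    (hθ0 : 0 ≤ θ) (hθ : θ ≤ δ₀ / 4)
    (hcoer : ∀ φ : ι → ℂ, γ * ∑ i, ‖φ i‖ ^ 2 ≤ (star φ ⬝ᵥ (M *ᵥ φ)).re)
    (hker : ∀ i j, ‖M i j‖ ≤ c₀ * Real.exp (-(δ₀ * ρ i j)))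
    (hsmall : θ * weightC (fun a => 2 * K a) c₀ δ₀ ≤ γ / 2) (i j : ι) :
    ‖M⁻¹ i j‖ ≤ 4 / γ * Real.exp (-(θ * ρ i j)) := by
  have hρ2d : IsPseudoDist (fun p q : ι × Fin 2 => ρ p.1 q.1) := isPseudoDist_prod hρ
  have hS2 : SumBound (fun p q : ι × Fin 2 => ρ p.1 q.1) (fun a => 2 * K a) := sumBound_prod hS
  have hkerS : ∀ p q : ι × Fin 2, |realify M p q| ≤ c₀ * Real.exp (-(δ₀ * ρ p.1 q.1)) := fun p q =>
    (abs_realify_apply_le M p q).trans (hker p.1 q.1)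
  have hrow : ∀ p : ι × Fin 2, ∑ q, |realify M p q| * (Real.exp (θ * ρ p.1 q.1) - 1) ≤ θ * weightC (fun a => 2 * K a) c₀ δ₀ :=
    fun p => B4Sect5Torus.weightedRowSum_le hρ2d.nonneg hS2 (realify M) hc hδ hθ0 hθ hkerS p
  have hcol : ∀ q : ι × Fin 2, ∑ p, |realify M p q| * (Real.exp (θ * ρ p.1 q.1) - 1) ≤ θ * weightC (fun a => 2 * K a) c₀ δ₀ :=
    fun q => B4Sect5Torus.weightedColSum_le hρ2d hS2 (realify M) hc hδ hθ0 hθ hkerS q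
  have hlt : θ * weightC (fun a => 2 * K a) c₀ δ₀ < γ := by linarith
  have hunit : IsUnit M := isUnit_of_re_coercive hγ hcoer
  have hCT : ∀ p q : ι × Fin 2, |realify M⁻¹ p q| ≤
      (γ - θ * weightC (fun a => 2 * K a) c₀ δ₀)⁻¹ * Real.exp (-(θ * ρ p.1 q.1)) := by
    intro p q
    rw [← realify_inv hunit]
    exact QGQInverse.inverse_decay (realify M) (fun p q : ι × Fin 2 => ρ p.1 q.1) hlt hθ0 (coercive_realify hcoer)
      hρ2d.symm hρ2d.zero hρ2d.triangle hrow hcol p q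
  have hgap : (γ - θ * weightC (fun a => 2 * K a) c₀ δ₀)⁻¹ ≤ 2 / γ := by
    rw [div_eq_mul_inv, show (2 : ℝ) * γ⁻¹ = (γ / 2)⁻¹ by rw [inv_div]; ring]
    exact inv_anti₀ (by linarith) (by linarith)
  have hre := hCT (i, 0) (j, 0)
  have him := hCT (i, 1) (j, 0)
  rw [realify_apply_fst] at hre
  rw [realify_apply_snd] at him
  have hE : 0 ≤ Real.exp (-(θ * ρ i j)) := (Real.exp_pos _).le
  calc ‖M⁻¹ i j‖ ≤ |(M⁻¹ i j).re| + |(M⁻¹ i j).im| := Complex.norm_le_abs_re_add_abs_im _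
    _ ≤ 2 / γ * Real.exp (-(θ * ρ i j)) + 2 / γ * Real.exp (-(θ * ρ i j)) :=
        add_le_add (hre.trans (mul_le_mul_of_nonneg_right hgap hE)) (him.trans (mul_le_mul_of_nonneg_right hgap hE))
    _ = 4 / γ * Real.exp (-(θ * ρ i j)) := by ring

end Realify

/-! ## §2 Torus geometry on `T^{(k)}`: the sup distance is a pseudo-distance with a volume-independent profile; two points of one `L`-block
are at distance `≤ L − 1`; the kernel of `P(u) = Q(u)^*Q(u)` lives on the blocks -/

section Torus

variable {P : Params} {j : ℕ}

/-- kernel: the sup torus distance `|·−·|_{T^{(k)}}` (p38's `B5Ineq137Torus.T`) is a pseudo-distance. [folklore] -/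
private theorem isPseudoDist_T (P : Params) (j : ℕ) : IsPseudoDist (B5Ineq137Torus.T P j) :=
  ⟨B5Ineq137Torus.T_symm P j, B5Ineq137Torus.T_self P j, B5Ineq137Torus.T_triangle P j⟩

/-- kernel: the exponential row sums of the torus are bounded by pv23's `K_d(a)` UNIFORMLY IN THE TORUS (p38's `rowSum_T_le`). [folklore] -/
private theorem sumBound_T (P : Params) (j : ℕ) : SumBound (B5Ineq137Torus.T P j) (B4Sect5Proof.latticeConst P.d) :=
  fun _ ha x => B5Ineq137Torus.rowSum_T_le P j ha x

/-- kernel: **two points of one `L`-block are at sup torus distance `≤ L − 1`** (their labels have the same quotient by `L` in every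
direction, [I] (2.4)). [cite: BalabanImbrieJaffe1985, (2.4) p.302] -/
theorem T_le_of_blkIter_eq (hj : j + 1 ≤ P.m + P.K) {x x' : Balaban1983to89.Site P j} (h : blkIter 1 x = blkIter 1 x') :
    B5Ineq137Torus.T P j x x' ≤ (P.L : ℝ) - 1 := by
  have hL : 1 ≤ P.L := P.L_pos
  have hN : 1 ≤ P.sitesPerDir j := (P.one_lt_sitesPerDir j).le
  have hc : ∀ μ : Fin P.d,
      B4Sect5Torus.ccoord (B5Ineq137Torus.Nv P j) (B5Ineq137Torus.toT x) (B5Ineq137Torus.toT x') μ ≤ P.L - 1 := by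
    intro μ
    have e1 := BIJ85BlockKPoincare.val_blkIter 1 hj x μ
    have e2 := BIJ85BlockKPoincare.val_blkIter 1 hj x' μ
    have hq : (x μ).val / P.L = (x' μ).val / P.L := by
      have hh : (blkIter 1 x μ).val = (blkIter 1 x' μ).val := by rw [h]
      rwa [e1, e2, pow_one] at hh
    obtain ⟨q, r, hr, hxe⟩ : ∃ q r : ℕ, r < P.L ∧ (x μ).val = P.L * q + r :=
      ⟨_, _, Nat.mod_lt (x μ).val P.L_pos, (Nat.div_add_mod (x μ).val P.L).symm⟩
    obtain ⟨q', r', hr', hxe'⟩ : ∃ q r : ℕ, r < P.L ∧ (x' μ).val = P.L * q + r :=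
      ⟨_, _, Nat.mod_lt (x' μ).val P.L_pos, (Nat.div_add_mod (x' μ).val P.L).symm⟩
    have hqq : q = q' := by
      have a1 : (x μ).val / P.L = q := by rw [hxe, Nat.mul_add_div P.L_pos, Nat.div_eq_of_lt hr, add_zero]
      have a2 : (x' μ).val / P.L = q' := by rw [hxe', Nat.mul_add_div P.L_pos, Nat.div_eq_of_lt hr', add_zero]
      rw [← a1, ← a2]; exact hq
    subst hqq
    have hz : |((x μ).val : ℤ) - ((x' μ).val : ℤ)| ≤ (P.L : ℤ) - 1 := by
      rw [hxe, hxe']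
      push_cast
      rw [show (P.L : ℤ) * q + r - ((P.L : ℤ) * q + r') = r - r' by ring, abs_le]
      constructor <;> omega
    have hcc := B4Sect5Torus.ccoord_cast (B5Ineq137Torus.Nv_pos P j) (B5Ineq137Torus.toT x) (B5Ineq137Torus.toT x') μ
    have hca := B4TorusKernel.MultiPeriod.circAbs_le_abs hN (((x μ).val : ℤ) - ((x' μ).val : ℤ))
    have hle : ((B4Sect5Torus.ccoord (B5Ineq137Torus.Nv P j) (B5Ineq137Torus.toT x) (B5Ineq137Torus.toT x') μ : ℕ) : ℤ) ≤
        (P.L : ℤ) - 1 := by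
      rw [hcc]; exact hca.trans hz
    omega
  unfold B5Ineq137Torus.T B4Sect5Torus.tdist
  have hsup : Finset.univ.sup (B4Sect5Torus.ccoord (B5Ineq137Torus.Nv P j) (B5Ineq137Torus.toT x) (B5Ineq137Torus.toT x')) ≤ P.L - 1 :=
    Finset.sup_le fun μ _ => hc μ
  have h1 : ((Finset.univ.sup (B4Sect5Torus.ccoord (B5Ineq137Torus.Nv P j) (B5Ineq137Torus.toT x) (B5Ineq137Torus.toT x')) : ℕ) : ℝ) ≤
      ((P.L - 1 : ℕ) : ℝ) := by exact_mod_cast hsup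
  rw [Nat.cast_sub hL, Nat.cast_one] at h1
  exact h1

/-- kernel: **`P(u) = Q(u)^*Q(u)` vanishes between different blocks** (`Q(u)(z,·)` is supported in `B(z)`). [cite: BalabanImbrieJaffe1988, (4.10) p.275] -/
theorem pOp_apply_of_ne (U : GaugeField P j U1) {x₁ x₂ : Balaban1983to89.Site P j} (h : blkIter 1 x₁ ≠ blkIter 1 x₂) :
    pOp U x₁ x₂ = 0 := by
  rw [pOp, mul_apply]
  refine sum_eq_zero fun z _ => ?_
  rw [conjTranspose_apply, qMatT_apply, qMatT_apply]
  by_cases h1 : x₁ ∈ blockK 1 z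
  · have h2 : x₂ ∉ blockK 1 z := fun h2 => h ((mem_blockK.1 h1).trans (mem_blockK.1 h2).symm)
    rw [if_neg h2, mul_zero]
  · rw [if_neg h1, star_zero, zero_mul]

/-- kernel: **`‖P(u)(x₁,x₂)‖ ≤ L^{−2d}`** (one term `z = ` the block of `x₁`; `|Q(u)(z,x)| ≤ L^{−d}`). [cite: BalabanImbrieJaffe1988, (4.10) p.275] -/
theorem norm_pOp_apply_le (U : GaugeField P j U1) (x₁ x₂ : Balaban1983to89.Site P j) :
    ‖pOp U x₁ x₂‖ ≤ (((P.L : ℝ) ^ P.d)⁻¹) ^ 2 := by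
  rw [pOp, mul_apply, Finset.sum_eq_single (blkIter 1 x₁)]
  · rw [conjTranspose_apply, norm_mul, norm_star, sq]
    have h1 := BIJ88DeltaLocFlatClose235.norm_qMatT_apply_le U 1 (blkIter 1 x₁) x₁
    have h2 := BIJ88DeltaLocFlatClose235.norm_qMatT_apply_le U 1 (blkIter 1 x₁) x₂
    rw [one_mul] at h1 h2
    exact mul_le_mul h1 h2 (norm_nonneg _) (by positivity)
  · intro z _ hz
    rw [conjTranspose_apply, qMatT_apply, if_neg (fun hh => hz (mem_blockK.1 hh).symm), star_zero, zero_mul]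
  · intro hh; exact absurd (mem_univ _) hh

/-- kernel: **the kernel of `Δ + κP(u)` decays like the kernel of `Δ`**: a bound `‖Δ(x₁,x₂)‖ ≤ c_Δe^{−δ₀|x₁−x₂|}` gives
`‖(Δ + κP(u))(x₁,x₂)‖ ≤ (c_Δ + κL^{−2d}e^{δ₀(L−1)})e^{−δ₀|x₁−x₂|}` (`P(u)` has range one block). [cite: BalabanImbrieJaffe1988, (2.40) p.264] -/
theorem norm_op240_apply_le (hj : j + 1 ≤ P.m + P.K) (U : GaugeField P j U1)
    {Δ : Matrix (Balaban1983to89.Site P j) (Balaban1983to89.Site P j) ℂ} {κ cΔ δ₀ : ℝ} (hκ : 0 ≤ κ) (hδ₀ : 0 ≤ δ₀)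
    {x₁ x₂ : Balaban1983to89.Site P j} (hΔ : ‖Δ x₁ x₂‖ ≤ cΔ * Real.exp (-(δ₀ * B5Ineq137Torus.T P j x₁ x₂))) :
    ‖op240 Δ κ U x₁ x₂‖ ≤
      (cΔ + κ * (((P.L : ℝ) ^ P.d)⁻¹) ^ 2 * Real.exp (δ₀ * ((P.L : ℝ) - 1))) * Real.exp (-(δ₀ * B5Ineq137Torus.T P j x₁ x₂)) := by
  rw [op240, Matrix.add_apply, Matrix.smul_apply, smul_eq_mul]
  have hP : ‖(κ : ℂ) * pOp U x₁ x₂‖ ≤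
      κ * (((P.L : ℝ) ^ P.d)⁻¹) ^ 2 * Real.exp (δ₀ * ((P.L : ℝ) - 1)) * Real.exp (-(δ₀ * B5Ineq137Torus.T P j x₁ x₂)) := by
    by_cases hb : blkIter 1 x₁ = blkIter 1 x₂
    · have hT := T_le_of_blkIter_eq hj hb
      rw [norm_mul, Complex.norm_real, Real.norm_of_nonneg hκ, mul_assoc, mul_assoc]
      refine mul_le_mul_of_nonneg_left ?_ hκ
      have hexp : Real.exp (-(δ₀ * ((P.L : ℝ) - 1))) ≤ Real.exp (-(δ₀ * B5Ineq137Torus.T P j x₁ x₂)) :=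
        Real.exp_le_exp.2 (by nlinarith)
      calc ‖pOp U x₁ x₂‖ ≤ (((P.L : ℝ) ^ P.d)⁻¹) ^ 2 := norm_pOp_apply_le U x₁ x₂
        _ = (((P.L : ℝ) ^ P.d)⁻¹) ^ 2 * (Real.exp (δ₀ * ((P.L : ℝ) - 1)) * Real.exp (-(δ₀ * ((P.L : ℝ) - 1)))) := by
            rw [← Real.exp_add, add_neg_cancel, Real.exp_zero, mul_one]
        _ ≤ (((P.L : ℝ) ^ P.d)⁻¹) ^ 2 * (Real.exp (δ₀ * ((P.L : ℝ) - 1)) * Real.exp (-(δ₀ * B5Ineq137Torus.T P j x₁ x₂))) :=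
            mul_le_mul_of_nonneg_left (mul_le_mul_of_nonneg_left hexp (Real.exp_pos _).le) (by positivity)
    · rw [pOp_apply_of_ne U hb, mul_zero, norm_zero]; positivity
  calc ‖Δ x₁ x₂ + (κ : ℂ) * pOp U x₁ x₂‖ ≤ ‖Δ x₁ x₂‖ + ‖(κ : ℂ) * pOp U x₁ x₂‖ := norm_add_le _ _
    _ ≤ cΔ * Real.exp (-(δ₀ * B5Ineq137Torus.T P j x₁ x₂)) +
          κ * (((P.L : ℝ) ^ P.d)⁻¹) ^ 2 * Real.exp (δ₀ * ((P.L : ℝ) - 1)) * Real.exp (-(δ₀ * B5Ineq137Torus.T P j x₁ x₂)) :=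
        add_le_add hΔ hP
    _ = _ := by ring

end Torus

/-! ## §3 **(2.41) AT FLAT `u` for any complex `Δ` with the (2.38)-shape bound and an exponentially localised kernel on `Λ`**:
`|C^{(k)}_Λ(1^{h′};x₁,x₂)| ≤ (4/(c₀(γ,κ) − E))·e^{−θ|x₁−x₂|_{T^{(k)}}}` -/

section Decay

variable {P : Params} {j : ℕ}

/-- kernel: `Σ_x ‖(ext v)(x)‖² = Σ_{i∈Λ} ‖v_i‖²`. [folklore] -/
private theorem sum_norm_sq_ext0 {S : Type*} [Fintype S] [DecidableEq S] (Λ : Finset S) (v : ↥Λ → ℂ) :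
    ∑ x, ‖ext0 Λ v x‖ ^ 2 = ∑ i : ↥Λ, ‖v i‖ ^ 2 := by
  have h1 : ∑ x, ‖ext0 Λ v x‖ ^ 2 = ∑ x ∈ Λ, ‖ext0 Λ v x‖ ^ 2 :=
    (Finset.sum_subset (Finset.subset_univ Λ) fun x _ hx => by
      rw [ext0_of_not_mem v hx, norm_zero, zero_pow two_ne_zero]).symm
  rw [h1, ← Finset.sum_coe_sort Λ]
  exact Finset.sum_congr rfl fun i _ => by rw [ext0_coe]

/-- **The form of `(Δ + κP(u))|_Λ` is coercive on `ℓ²(Λ)`** at a pure gauge: `(c₀(γ,κ) − E)·Σ_{i∈Λ}‖v_i‖² ≤ Re vᴴ(Δ + κP(u))|_Λv` — gen 18's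
`lowerBound_op240_flat` (p. 264 *"By (2.38), … is bounded below"*) read on the compression. [cite: BalabanImbrieJaffe1988, (2.40) p.264] -/
theorem re_coercive_compress (hj : j + 1 ≤ P.m + P.K) (h' : GaugeTransf P j U1)
    {Δ : Matrix (Balaban1983to89.Site P j) (Balaban1983to89.Site P j) ℂ} {Λ : Finset (Balaban1983to89.Site P j)} {γ E κ : ℝ}
    (hγ : 0 ≤ γ) (hκ : 0 ≤ κ)
    (h238 : ∀ φ : Balaban1983to89.Site P j → ℂ, (∀ x ∉ Λ, φ x = 0) →
      γ * ∑ b : PBond P j, ‖toC (h' b.src) * (toC (h' b.tgt))⁻¹ * φ b.tgt - φ b.src‖ ^ 2 - E * ∑ x, ‖φ x‖ ^ 2 ≤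
        (star φ ⬝ᵥ (Δ *ᵥ φ)).re)
    (v : ↥Λ → ℂ) :
    (c240 P γ κ - E) * ∑ i, ‖v i‖ ^ 2 ≤ (star v ⬝ᵥ (compress Λ (op240 Δ κ (gaugeAct h' (1 : GaugeField P j U1))) *ᵥ v)).re := by
  rw [star_dotProduct_compress, ← sum_norm_sq_ext0 Λ v]
  exact lowerBound_op240_flat hj h' hγ hκ h238 (ext0 Λ v) (fun x hx => ext0_of_not_mem v hx)

/-- **(2.41) AT EVERY FLAT / PURE-GAUGE BACKGROUND, for any complex `Δ`** (*"by (2.38), C^{(k)}_Λ(u)^{−1} is bounded below and a random walk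
expansion as in [6] can be used to prove that |C^{(k)}_Λ(u; x₁, x₂)| ≦ ce^{−c|x₁−x₂|}. (2.41)"*, p. 264): on `T^{(k)}` (any level with a next one),
let `Δ` satisfy the (2.38)-SHAPE bound `γΣ_b|u(b)φ(b₊)−φ(b₋)|² − E‖φ‖² ≤ Re φᴴΔφ` on the fields supported in `Λ` at `u = 1^{h′}` with `E < c₀(γ,κ)`
(gen 18's flat Poincaré constant `c240`), and the kernel bound `‖Δ(x₁,x₂)‖ ≤ c_Δe^{−δ₀|x₁−x₂|_{T^{(k)}}}` on `Λ × Λ` ((2.36)-shape). Then for every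
rate `0 ≤ θ ≤ δ₀/4` with `θ·(c_Δ + κL^{−2d}e^{δ₀(L−1)})(4/δ₀)·2K_d(δ₀/2) ≤ (c₀(γ,κ) − E)/2`, the propagator
`C^{(k)}_Λ(1^{h′}) = [(Δ + κQ(u)^*Q(u))|_Λ]^{−1}` of gen 18's `eq240_flat` obeys `‖C^{(k)}_Λ(1^{h′};x₁,x₂)‖ ≤ (4/(c₀(γ,κ) − E))·e^{−θ|x₁−x₂|_{T^{(k)}}}`,
uniformly in the torus and in `Λ`. The two printed inputs by name (lower bound: `re_coercive_compress`; locality: `norm_op240_apply_le`); the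
engine is [6] Sect. 5 as kernel-proved in the tree (`norm_inv_apply_le`). [cite: BalabanImbrieJaffe1988, (2.41) p.264] -/
theorem decay241_flat (hj : j + 1 ≤ P.m + P.K) (h' : GaugeTransf P j U1)
    {Δ : Matrix (Balaban1983to89.Site P j) (Balaban1983to89.Site P j) ℂ} {Λ : Finset (Balaban1983to89.Site P j)} {γ E κ : ℝ}
    (hγ : 0 ≤ γ) (hκ : 0 ≤ κ) (hE : E < c240 P γ κ)
    (h238 : ∀ φ : Balaban1983to89.Site P j → ℂ, (∀ x ∉ Λ, φ x = 0) →
      γ * ∑ b : PBond P j, ‖toC (h' b.src) * (toC (h' b.tgt))⁻¹ * φ b.tgt - φ b.src‖ ^ 2 - E * ∑ x, ‖φ x‖ ^ 2 ≤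
        (star φ ⬝ᵥ (Δ *ᵥ φ)).re)
    {cΔ δ₀ θ : ℝ} (hcΔ : 0 ≤ cΔ) (hδ₀ : 0 < δ₀)
    (hker : ∀ x₁ ∈ Λ, ∀ x₂ ∈ Λ, ‖Δ x₁ x₂‖ ≤ cΔ * Real.exp (-(δ₀ * B5Ineq137Torus.T P j x₁ x₂)))
    (hθ0 : 0 ≤ θ) (hθ : θ ≤ δ₀ / 4)
    (hsmall : θ * weightC (fun t => 2 * B4Sect5Proof.latticeConst P.d t)
        (cΔ + κ * (((P.L : ℝ) ^ P.d)⁻¹) ^ 2 * Real.exp (δ₀ * ((P.L : ℝ) - 1))) δ₀ ≤ (c240 P γ κ - E) / 2)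
    (x₁ x₂ : ↥Λ) :
    ‖(compress Λ (op240 Δ κ (gaugeAct h' (1 : GaugeField P j U1))))⁻¹ x₁ x₂‖ ≤
      4 / (c240 P γ κ - E) * Real.exp (-(θ * B5Ineq137Torus.T P j x₁ x₂)) := by
  have hρ : IsPseudoDist (fun a b : ↥Λ => B5Ineq137Torus.T P j a b) := (isPseudoDist_T P j).comp Subtype.val
  have hS : SumBound (fun a b : ↥Λ => B5Ineq137Torus.T P j a b) (B4Sect5Proof.latticeConst P.d) :=
    (sumBound_T P j).comp Subtype.val_injective
  have hc : 0 ≤ cΔ + κ * (((P.L : ℝ) ^ P.d)⁻¹) ^ 2 * Real.exp (δ₀ * ((P.L : ℝ) - 1)) := by positivity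
  exact norm_inv_apply_le hρ hS (by linarith) hc hδ₀ hθ0 hθ (re_coercive_compress hj h' hγ hκ h238)
    (fun a b => norm_op240_apply_le hj _ hκ hδ₀.le (hker a a.2 b b.2)) hsmall x₁ x₂

end Decay

/-! ## §4 **(2.41) AT EVERY PURE-GAUGE BACKGROUND FOR GEN 15's CONCRETE `Δ_{k,loc}(1^h)`**, constants chosen before the instance -/

section Concrete

open BIJ88NeumannPropagatorFlatDecayCube (cubeT)
open BIJ88NeumannNoZeroModesTorus (IsBlockUnion innerK)
open BIJ88Sect3Statements (starB)
open BIJ88Ineq238FlatTorus (ineq238_flat_mult aSeq_ge)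
open BIJ88DeltaLocFlatClose235 (decay236_flat_level)

variable {d : ℕ}

/-- kernel: `L^{k+n}ε = L^n·L^kε`. [folklore] -/
private theorem spacing_add (P : Params) (k n : ℕ) : P.spacing (k + n) = (P.L : ℝ) ^ n * P.spacing k := by
  induction n with
  | zero => simp
  | succ n ih => rw [← add_assoc, P.spacing_succ, ih, pow_succ]; ring

/-- kernel: the lattice spacings `L^kε ≤ 1` for `k ≤ K` (`L^Kε = 1`; also pv-lineage `B3GkZeroTorusRescaled.spacing_le_one`, not imported to keep
the import closure inside this seat's flat lane). [folklore] -/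
private theorem spacing_le_one (P : Params) {k : ℕ} (hk : k ≤ P.K) : P.spacing k ≤ 1 := by
  obtain ⟨n, hn⟩ := Nat.exists_eq_add_of_le hk
  have h1 : P.spacing P.K = (P.L : ℝ) ^ n * P.spacing k := by rw [hn, spacing_add]
  rw [P.spacing_K] at h1
  have hLn : (1 : ℝ) ≤ (P.L : ℝ) ^ n := one_le_pow₀ (B1RG242Torus.one_lt_cast_L P).le
  have hs := P.spacing_pos k
  nlinarith

/-- kernel: **gen 15's counting normalization is at least one**: `A/a_k = L^{kd}/(L^kε)² ≥ 1` (`A = α_k(a)L^{kd}`, `α_k = a_k(L^kε)^{−2}`), so a bound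
`(a_k/A)·c·e^{−δ|x₁−x₂|}` implies the printed shape `c·e^{−δ|x₁−x₂|}`. [cite: BalabanImbrieJaffe1988, (2.34) p.263] -/
theorem one_le_ratio (P : Params) {a : ℝ} (ha : 0 < a) {k : ℕ} (hk1 : 1 ≤ k) (hkK : k ≤ P.K) :
    1 ≤ B1RG242Torus.α P a k * (P.L : ℝ) ^ (k * P.d) / B1.aSeq a P.L k := by
  have hak : 0 < B1.aSeq a P.L k := B1.aSeq_pos ha (B1RG242Torus.one_lt_cast_L P) hk1
  have hs : 0 < P.spacing k := P.spacing_pos k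
  have hs1 : P.spacing k ≤ 1 := spacing_le_one P hkK
  have e : B1RG242Torus.α P a k * (P.L : ℝ) ^ (k * P.d) / B1.aSeq a P.L k = (P.spacing k ^ 2)⁻¹ * (P.L : ℝ) ^ (k * P.d) := by
    unfold B1RG242Torus.α
    field_simp
  rw [e]
  have h1 : (1 : ℝ) ≤ (P.spacing k ^ 2)⁻¹ := by
    rw [one_le_inv_iff₀]
    exact ⟨by positivity, by nlinarith⟩
  have h2 : (1 : ℝ) ≤ (P.L : ℝ) ^ (k * P.d) := one_le_pow₀ (B1RG242Torus.one_lt_cast_L P).le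
  nlinarith

/-- kernel: the flat Poincaré constant scales linearly: `c₀(sγ, sκ) = s·c₀(γ, κ)` for `s ≥ 0`. [cite: BalabanImbrieJaffe1988, (2.40) p.264] -/
theorem c240_smul (P : Params) {s : ℝ} (hs : 0 ≤ s) (γ κ : ℝ) : c240 P (s * γ) (s * κ) = s * c240 P γ κ := by
  unfold c240
  rw [(monotone_mul_left_of_nonneg hs).map_min, mul_div_assoc, mul_div_assoc]

/-- kernel: the flat Poincaré constant is monotone in the (2.38) coefficient `γ`. [cite: BalabanImbrieJaffe1988, (2.40) p.264] -/
theorem c240_mono (P : Params) {γ γ' : ℝ} (h : γ ≤ γ') (κ : ℝ) : c240 P γ κ ≤ c240 P γ' κ := by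
  have hL2 : 2 ≤ P.L := P.hL.2
  have hL : (2 : ℝ) ≤ P.L := by exact_mod_cast hL2
  have hA : (0 : ℝ) < 2 * (((P.L : ℝ) - 1) * P.L) := by nlinarith
  unfold c240
  exact min_le_min (div_le_div_of_nonneg_right h hA.le) le_rfl

/-- kernel: `[y₁ = y₂] ≤ e^{−δ|y₁−y₂|}`. [folklore] -/
private theorem ite_le_exp (P : Params) (j : ℕ) (δ : ℝ) (y₁ y₂ : Balaban1983to89.Site P j) :
    (if y₁ = y₂ then (1 : ℝ) else 0) ≤ Real.exp (-(δ * B5Ineq137Torus.T P j y₁ y₂)) := by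
  split_ifs with h
  · rw [h, B5Ineq137Torus.T_self, mul_zero, neg_zero, Real.exp_zero]
  · exact (Real.exp_pos _).le

/-- **(2.41) AT EVERY FLAT / PURE-GAUGE BACKGROUND FOR GEN 15's `Δ_{k,loc}(1^h)`, constants chosen BEFORE the instance** (*"by (2.38),
C^{(k)}_Λ(u)^{−1} is bounded below and a random walk expansion as in [6] can be used to prove that |C^{(k)}_Λ(u; x₁, x₂)| ≦ ce^{−c|x₁−x₂|}.
(2.41)"*, p. 264): for every `(d, L, a)`, multiplicity `m` and `Q^*Q`-coefficient `κ̂ > 0` there are `δ₀, c₁` (the (2.35)/(2.38) constants of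
`ineq238_flat_mult`) and `δ₁, c₂ > 0` such that, on every torus of the model, at every level `1 ≤ k ≤ K` with a next lattice, under EXACTLY the
data hypotheses of gen 18's `eq240_deltaLocT_flat` (cubes nested in the no-wrap box `Ω₀`, `Σ|λ_α| ≤ 1`, `0 ≤ ζ″ ≤ 1`, the (2.35) row hypotheses
(i)–(iii) with multiplicity `m` on every block row of `Λ`, every unit bond meeting `Λ` inside `Ω₀^{(k)*}`, `Λ` a union of `L`-blocks) and the
(2.35)-error AT MOST HALF the flat Poincaré constant, `(A/a_k)a_k²c₁(m·e^{−2δ₀R/L^k} + e^{−(δ₀/2)R₁/L^k}) ≤ ½c₀((A/a_k)min(a_k/(8d),½), (A/a_k)κ̂)`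
(true for the printed radii `R, R₁ ~ r(e_k)L^k` once `r(e_k)` is large), the propagator `C^{(k)}_Λ(1^h) = [(Δ_{k,loc}(1^h) + (A/a_k)κ̂·Q(u_k)^*Q(u_k))|_Λ]^{−1}`
satisfies **`‖C^{(k)}_Λ(1^h; x₁, x₂)‖ ≤ (a_k/A)·c₂·e^{−δ₁|x₁−x₂|_{T^{(k)}}}`** for all `x₁, x₂ ∈ Λ` — uniformly in `ε`, the torus, `k`, `Λ`, `h`,
the cube data and the radii (`A/a_k ≥ 1` is gen 15's counting normalization, in which `Δ_{k,loc}`, `κ` and `C^{−1}` all carry the factor `A/a_k`;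
the printed `aL^{−2}` is `κ̂ = aL^{−2}`).  Inputs BY NAME: this seat's `ineq238_flat_mult` ((2.38) at flat `u`) through gen 18's `lowerBound_op240_flat`,
gen 17's `decay236_flat_level` ((2.36) in level-`k` units), the one-block range of `Q^*Q`; engine §1/§3. [cite: BalabanImbrieJaffe1988, (2.41) p.264] -/
theorem decay241_deltaLocT_flat (d ℓ : ℕ) (hℓ : 1 ≤ ℓ) {a : ℝ} (ha : 0 < a) (m : ℕ) {κ' : ℝ} (hκ' : 0 < κ') :
    ∃ δ₀ c₁ δ₁ c₂ : ℝ, 0 < δ₀ ∧ 0 < c₁ ∧ 0 < δ₁ ∧ 0 < c₂ ∧ ∀ (P : Params) (hPd : P.d = d + 1), P.L = ℓ + 1 →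
      ∀ k : ℕ, 1 ≤ k → k ≤ P.K → k + 1 ≤ P.m + P.K → ∀ (c M0 : Fin (d + 1) → ℕ), (∀ i, 1 ≤ M0 i) →
        (∀ i, c i * P.L ^ k + P.L ^ k * M0 i ≤ P.sitesPerDir 0) → (∀ i, P.L ^ k * M0 i < P.sitesPerDir 0) →
      ∀ (ι : Type) [Fintype ι] (cube : ι → Finset (Balaban1983to89.Site P 0))
        (lam : ι → Balaban1983to89.Site P 0 → Balaban1983to89.Site P 0 → ℝ)
        (ζ'' : Balaban1983to89.Site P 0 → Balaban1983to89.Site P 0 → ℝ),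
        (∀ α, ∃ t M : Fin (d + 1) → ℕ, (∀ i, 1 ≤ M i) ∧ (∀ i, t i + M i ≤ M0 i) ∧
            cube α = cubeT hPd (P.L ^ k) (c + t) fun i => P.L ^ k * M i) →
        (∀ x y, ∑ α, |lam α x y| ≤ 1) → (∀ x y, 0 ≤ ζ'' x y ∧ ζ'' x y ≤ 1) →
      ∀ (h : GaugeTransf P 0 U1) (R R₁ : ℝ), 0 ≤ R → 0 ≤ R₁ → ∀ (Λ : Finset (Balaban1983to89.Site P (0 + k))),
        IsBlockUnion 1 Λ →
        (∀ y₁ ∈ Λ,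
          (∀ x ∈ blockK k y₁, ∀ y, ζ'' x y ≠ 0 → ∑ α, lam α x y = 1) ∧
          (∀ x ∈ blockK k y₁, ∀ α y, ζ'' x y * lam α x y ≠ 0 → x ∈ cube α ∧ y ∈ cube α ∧
              ∀ w ∈ cubeT hPd (P.L ^ k) c (fun i => P.L ^ k * M0 i), w ∉ cube α →
                R ≤ B5Ineq137Torus.T P 0 x w ∧ R ≤ B5Ineq137Torus.T P 0 y w) ∧
          (∀ x ∈ blockK k y₁, ∀ y, B5Ineq137Torus.T P 0 x y ≤ R₁ → ζ'' x y = 1) ∧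
          ∃ S : Finset ι, S.card ≤ m ∧ ∀ x ∈ blockK k y₁, ∀ α y, ζ'' x y * lam α x y ≠ 0 → α ∈ S) →
        (∀ b : PBond P (0 + k), (b.src ∈ Λ ∨ b.tgt ∈ Λ) →
          b ∈ starB (innerK k (cubeT hPd (P.L ^ k) c fun i => P.L ^ k * M0 i))) →
        (B1RG242Torus.α P a k * (P.L : ℝ) ^ (k * P.d)) / B1.aSeq a P.L k *
            (B1.aSeq a P.L k ^ 2 * c₁ *
              ((m : ℝ) * Real.exp (-(δ₀ * (((P.L : ℝ) ^ k)⁻¹ * (2 * R)))) + Real.exp (-(δ₀ / 2 * (((P.L : ℝ) ^ k)⁻¹ * R₁))))) ≤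
          1 / 2 * c240 P ((B1RG242Torus.α P a k * (P.L : ℝ) ^ (k * P.d)) / B1.aSeq a P.L k * min (B1.aSeq a P.L k / (8 * P.d)) (1 / 2))
            ((B1RG242Torus.α P a k * (P.L : ℝ) ^ (k * P.d)) / B1.aSeq a P.L k * κ') →
      ∀ x₁ x₂ : ↥Λ,
        ‖(compress Λ (op240 (deltaLocT (B1RG242Torus.α P a k * (P.L : ℝ) ^ (k * P.d)) P.eps⁻¹ (gaugeAct h (1 : GaugeField P 0 U1)) k
            cube lam ζ'') ((B1RG242Torus.α P a k * (P.L : ℝ) ^ (k * P.d)) / B1.aSeq a P.L k * κ')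
            (gaugeAct (fun y => h (cornerIter k y)) (1 : GaugeField P (0 + k) U1))))⁻¹ x₁ x₂‖ ≤
          ((B1RG242Torus.α P a k * (P.L : ℝ) ^ (k * P.d)) / B1.aSeq a P.L k)⁻¹ * c₂ *
            Real.exp (-(δ₁ * B5Ineq137Torus.T P (0 + k) x₁ x₂)) := by
  obtain ⟨δ₀, c₁, hδ₀, hc₁, H238⟩ := ineq238_flat_mult d ℓ hℓ ha
  obtain ⟨δ₀', c₀', hδ₀', hc₀', H236⟩ := decay236_flat_level d ℓ hℓ ha
  -- the k-uniform constants (opaque abbreviations with their defining equations)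
  have hℓr : (1 : ℝ) ≤ ℓ := by exact_mod_cast hℓ
  obtain ⟨gS, hgS⟩ : ∃ x : ℝ, x = min (a * (1 - (((ℓ : ℝ) + 1) ^ 2)⁻¹) / (8 * ((d : ℝ) + 1))) (1 / 2) := ⟨_, rfl⟩
  obtain ⟨cS, hcS⟩ : ∃ x : ℝ, x = min (gS / (2 * ((ℓ : ℝ) * ((ℓ : ℝ) + 1)))) (κ' / (2 * ((ℓ : ℝ) + 1) ^ (d + 1))) := ⟨_, rfl⟩
  obtain ⟨W, hW⟩ : ∃ x : ℝ, x = 4 / δ₀' * (2 * B4Sect5Proof.latticeConst (d + 1) (δ₀' / 2)) := ⟨_, rfl⟩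
  obtain ⟨c0S, hc0S⟩ : ∃ x : ℝ,
      x = a * (1 + m * a * c₀') + κ' * (((((ℓ : ℝ) + 1) ^ (d + 1))⁻¹) ^ 2 * Real.exp (δ₀' * ℓ)) := ⟨_, rfl⟩
  obtain ⟨θS, hθS⟩ : ∃ x : ℝ, x = min (δ₀' / 4) (cS / (4 * (c0S * W + 1))) := ⟨_, rfl⟩
  have hsq : 0 < 1 - (((ℓ : ℝ) + 1) ^ 2)⁻¹ := by
    have h4 : (4 : ℝ) ≤ ((ℓ : ℝ) + 1) ^ 2 := by nlinarith
    have : (((ℓ : ℝ) + 1) ^ 2)⁻¹ ≤ 4⁻¹ := inv_anti₀ (by norm_num) h4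
    linarith
  have hgS0 : 0 < gS := by rw [hgS]; exact lt_min (by positivity) (by norm_num)
  have hcS0 : 0 < cS := by rw [hcS]; exact lt_min (by positivity) (by positivity)
  have hW0 : 0 ≤ W := by
    have := B4Sect5Proof.latticeConst_nonneg (d + 1) (half_pos hδ₀').le
    rw [hW]; positivity
  have hc0S0 : 0 < c0S := by rw [hc0S]; positivity
  have hθS0 : 0 < θS := by rw [hθS]; exact lt_min (by positivity) (by positivity)
  have hθ4 : θS ≤ δ₀' / 4 := by rw [hθS]; exact min_le_left _ _
  have hθc : θS ≤ cS / (4 * (c0S * W + 1)) := by rw [hθS]; exact min_le_right _ _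
  refine ⟨δ₀, c₁, θS, 8 / cS, hδ₀, hc₁, hθS0, by positivity, ?_⟩
  intro P hPd hPL k hk1 hkK hk' c M0 hM0 hfit0 hN0 ι _ cube lam ζ hcube hlam hζ h R R₁ hR hR₁ Λ hΛ hrows hbonds hmargin x₁ x₂
  have hLr : (P.L : ℝ) = (ℓ : ℝ) + 1 := by rw [hPL]; push_cast; ring
  have hdr : (P.d : ℝ) = (d : ℝ) + 1 := by rw [hPd]; push_cast; ring
  have hj : (0 + k) + 1 ≤ P.m + P.K := by omega
  -- the (2.38)-shape bound on the fields supported in Λ (raw form), then fold the normalization constants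
  have h238raw := H238 P hPd hPL k hk1 hkK c M0 hM0 hfit0 hN0 ι cube lam ζ hcube hlam hζ h R R₁ hR hR₁ m (fun φ => ∀ x ∉ Λ, φ x = 0)
    (fun φ hφ y₁ hy₁ => hrows y₁ (by by_contra hh; exact hy₁ (hφ y₁ hh)))
    (fun φ hφ b hb => hbonds b (hb.imp (fun h1 => by by_contra hh; exact h1 (hφ _ hh)) (fun h1 => by by_contra hh; exact h1 (hφ _ hh))))
  clear H238
  have hak0 : 0 < B1.aSeq a P.L k := B1.aSeq_pos ha (B1RG242Torus.one_lt_cast_L P) hk1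
  have hα : 0 < B1RG242Torus.α P a k := mul_pos hak0 (inv_pos.mpr (pow_pos (P.spacing_pos k) 2))
  have hA0 : 0 < B1RG242Torus.α P a k * (P.L : ℝ) ^ (k * P.d) := mul_pos hα (pow_pos P.cast_L_pos _)
  have hs1 : 1 ≤ B1RG242Torus.α P a k * (P.L : ℝ) ^ (k * P.d) / B1.aSeq a P.L k := one_le_ratio P ha hk1 hkK
  have hak_le' : B1.aSeq a P.L k ≤ a := B1.aSeq_le ha (B1RG242Torus.one_lt_cast_L P) k hk1
  have hak_ge' : a * (1 - (((ℓ : ℝ) + 1) ^ 2)⁻¹) ≤ B1.aSeq a P.L k := by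
    rw [← hLr]; exact aSeq_ge ha.le (B1RG242Torus.one_lt_cast_L P) hk1
  obtain ⟨A, hAdef⟩ : ∃ x : ℝ, x = B1RG242Torus.α P a k * (P.L : ℝ) ^ (k * P.d) := ⟨_, rfl⟩
  obtain ⟨ak, hakdef⟩ : ∃ x : ℝ, x = B1.aSeq a P.L k := ⟨_, rfl⟩
  rw [← hAdef, ← hakdef] at h238raw hmargin hs1 ⊢
  rw [← hAdef] at hA0
  rw [← hakdef] at hak0 hak_le' hak_ge'
  obtain ⟨s, hsdef⟩ : ∃ x : ℝ, x = A / ak := ⟨_, rfl⟩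
  rw [← hsdef] at h238raw hmargin hs1 ⊢
  have hs0 : 0 < s := by rw [hsdef]; exact div_pos hA0 hak0
  have hsak : s * ak = A := by rw [hsdef]; field_simp
  -- the (2.38)-shape
  obtain ⟨gk, hgk⟩ : ∃ x : ℝ, x = min (ak / (8 * P.d)) (1 / 2) := ⟨_, rfl⟩
  obtain ⟨br, hbr⟩ : ∃ x : ℝ,
      x = (m : ℝ) * Real.exp (-(δ₀ * (((P.L : ℝ) ^ k)⁻¹ * (2 * R)))) + Real.exp (-(δ₀ / 2 * (((P.L : ℝ) ^ k)⁻¹ * R₁))) := ⟨_, rfl⟩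
  rw [← hgk, ← hbr] at h238raw hmargin
  have h238 : ∀ φ : Balaban1983to89.Site P (0 + k) → ℂ, (∀ x ∉ Λ, φ x = 0) →
      s * gk * ∑ b : PBond P (0 + k), ‖toC (h (cornerIter k b.src)) * (toC (h (cornerIter k b.tgt)))⁻¹ * φ b.tgt - φ b.src‖ ^ 2 -
        s * (ak ^ 2 * c₁ * br) * ∑ x, ‖φ x‖ ^ 2 ≤
      (star φ ⬝ᵥ (deltaLocT A P.eps⁻¹ (gaugeAct h (1 : GaugeField P 0 U1)) k cube lam ζ *ᵥ φ)).re := by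
    intro φ hφ
    have := h238raw φ hφ
    linarith only [this]
  -- the Poincaré constant and the (2.35)-error
  have hgk_ge : gS ≤ gk := by
    rw [hgS, hgk, hdr]
    exact min_le_min (div_le_div_of_nonneg_right hak_ge' (by positivity)) le_rfl
  have hgk0 : 0 ≤ gk := hgS0.le.trans hgk_ge
  have hc240S : c240 P gS κ' = cS := by
    rw [c240, hPd, hLr, hcS, show ((ℓ : ℝ) + 1 - 1) * ((ℓ : ℝ) + 1) = (ℓ : ℝ) * ((ℓ : ℝ) + 1) by ring]
  have hc240k : s * cS ≤ c240 P (s * gk) (s * κ') := by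
    rw [c240_smul P hs0.le, ← hc240S]
    exact mul_le_mul_of_nonneg_left (c240_mono P hgk_ge κ') hs0.le
  obtain ⟨E, hE⟩ : ∃ x : ℝ, x = s * (ak ^ 2 * c₁ * br) := ⟨_, rfl⟩
  obtain ⟨cv, hcv⟩ : ∃ x : ℝ, x = c240 P (s * gk) (s * κ') := ⟨_, rfl⟩
  rw [← hE] at h238 hmargin
  rw [← hcv] at hmargin hc240k
  have hcv0 : 0 < cv := lt_of_lt_of_le (mul_pos hs0 hcS0) hc240k
  have hElt : E < cv := by linarith only [hmargin, hcv0]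
  have hγco : s * cS / 2 ≤ cv - E := by linarith only [hmargin, hc240k, hcv0]
  have hγco0 : 0 < cv - E := by linarith only [hγco, mul_pos hs0 hcS0]
  -- the kernel bound (2.36) in level-k units on the rows of Λ
  have hζabs : ∀ x y, |ζ x y| ≤ 1 := fun x y => abs_le.2 ⟨by linarith only [(hζ x y).1], (hζ x y).2⟩
  have hcube' : ∀ α, ∃ c' M : Fin (d + 1) → ℕ, (∀ i, 1 ≤ M i) ∧ (∀ i, c' i * P.L ^ k + P.L ^ k * M i ≤ P.sitesPerDir 0) ∧
      (∀ i, P.L ^ k * M i < P.sitesPerDir 0) ∧ cube α = cubeT hPd (P.L ^ k) c' fun i => P.L ^ k * M i := by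
    intro α
    obtain ⟨t, M, hM1, htM, hc⟩ := hcube α
    refine ⟨c + t, M, hM1, fun i => ?_, fun i => ?_, hc⟩
    · have h1 := hfit0 i
      have h2 := htM i
      calc (c + t) i * P.L ^ k + P.L ^ k * M i = c i * P.L ^ k + P.L ^ k * (t i + M i) := by rw [Pi.add_apply]; ring
        _ ≤ c i * P.L ^ k + P.L ^ k * M0 i := by gcongr
        _ ≤ P.sitesPerDir 0 := h1
    · exact lt_of_le_of_lt (Nat.mul_le_mul_left _ (by have := htM i; omega)) (hN0 i)
  obtain ⟨cΔ, hcΔ⟩ : ∃ x : ℝ, x = A * (1 + m * ak * c₀') := ⟨_, rfl⟩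
  have hcΔ0 : 0 ≤ cΔ := by rw [hcΔ]; positivity
  have hker : ∀ y₁ ∈ Λ, ∀ y₂ ∈ Λ,
      ‖deltaLocT A P.eps⁻¹ (gaugeAct h (1 : GaugeField P 0 U1)) k cube lam ζ y₁ y₂‖ ≤
        cΔ * Real.exp (-(δ₀' * B5Ineq137Torus.T P (0 + k) y₁ y₂)) := by
    intro y₁ hy₁ y₂ _
    obtain ⟨S, hSm, hS⟩ := (hrows y₁ hy₁).2.2.2
    have h236 := H236 P hPd hPL k hk1 hkK ι cube lam ζ hcube' hlam hζabs h y₁ y₂ S hS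
    rw [← hAdef, ← hakdef] at h236
    refine h236.trans ?_
    have hSm' : (S.card : ℝ) ≤ m := by exact_mod_cast hSm
    have he := ite_le_exp P (0 + k) δ₀' y₁ y₂
    have he0 : 0 ≤ Real.exp (-(δ₀' * B5Ineq137Torus.T P (0 + k) y₁ y₂)) := (Real.exp_pos _).le
    have h1 : (S.card : ℝ) * ak * c₀' * Real.exp (-(δ₀' * B5Ineq137Torus.T P (0 + k) y₁ y₂)) ≤
        (m : ℝ) * ak * c₀' * Real.exp (-(δ₀' * B5Ineq137Torus.T P (0 + k) y₁ y₂)) := by gcongr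
    calc A * ((if y₁ = y₂ then 1 else 0) + (S.card : ℝ) * ak * c₀' * Real.exp (-(δ₀' * B5Ineq137Torus.T P (0 + k) y₁ y₂)))
        ≤ A * (Real.exp (-(δ₀' * B5Ineq137Torus.T P (0 + k) y₁ y₂)) +
            (m : ℝ) * ak * c₀' * Real.exp (-(δ₀' * B5Ineq137Torus.T P (0 + k) y₁ y₂))) :=
          mul_le_mul_of_nonneg_left (add_le_add he h1) hA0.le
      _ = cΔ * Real.exp (-(δ₀' * B5Ineq137Torus.T P (0 + k) y₁ y₂)) := by rw [hcΔ]; ring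
  clear H236
  -- assemble §3
  obtain ⟨ct, hct⟩ : ∃ x : ℝ, x = cΔ + s * κ' * (((P.L : ℝ) ^ P.d)⁻¹) ^ 2 * Real.exp (δ₀' * ((P.L : ℝ) - 1)) := ⟨_, rfl⟩
  have hct_le : ct ≤ s * c0S := by
    have h1 : cΔ = s * (ak * (1 + m * ak * c₀')) := by rw [hcΔ, ← hsak]; ring
    have h2 : ak * (1 + m * ak * c₀') ≤ a * (1 + m * a * c₀') := by
      have h21 : (m : ℝ) * ak * c₀' ≤ m * a * c₀' := by gcongr
      have h22 : 0 ≤ 1 + (m : ℝ) * ak * c₀' := by positivity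
      calc ak * (1 + m * ak * c₀') ≤ a * (1 + m * ak * c₀') := mul_le_mul_of_nonneg_right hak_le' h22
        _ ≤ a * (1 + m * a * c₀') := by gcongr
    have h3 : (((P.L : ℝ) ^ P.d)⁻¹) ^ 2 * Real.exp (δ₀' * ((P.L : ℝ) - 1)) =
        (((((ℓ : ℝ) + 1) ^ (d + 1))⁻¹) ^ 2) * Real.exp (δ₀' * ℓ) := by
      rw [hPd, hLr, show (ℓ : ℝ) + 1 - 1 = ℓ by ring]
    have h4 : s * κ' * (((P.L : ℝ) ^ P.d)⁻¹) ^ 2 * Real.exp (δ₀' * ((P.L : ℝ) - 1)) =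
        s * (κ' * ((((((ℓ : ℝ) + 1) ^ (d + 1))⁻¹) ^ 2) * Real.exp (δ₀' * ℓ))) := by
      rw [mul_assoc (s * κ'), h3, mul_assoc]
    rw [hct, h1, h4, hc0S, ← mul_add]
    exact mul_le_mul_of_nonneg_left (add_le_add h2 le_rfl) hs0.le
  have hwC : weightC (fun t => 2 * B4Sect5Proof.latticeConst P.d t) ct δ₀' = ct * W := by
    rw [B4Sect5Torus.weightC, hW, hPd]; ring
  have hct0 : 0 ≤ ct := by rw [hct]; positivity
  have hsmall : θS * weightC (fun t => 2 * B4Sect5Proof.latticeConst P.d t) ct δ₀' ≤ (cv - E) / 2 := by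
    rw [hwC]
    have h2 : θS * (ct * W) ≤ cS / (4 * (c0S * W + 1)) * (s * c0S * W) := by
      have : ct * W ≤ s * c0S * W := mul_le_mul_of_nonneg_right hct_le hW0
      exact mul_le_mul hθc this (by positivity) (by positivity)
    have h3 : cS / (4 * (c0S * W + 1)) * (s * c0S * W) ≤ s * cS / 4 := by
      have hden : 0 < 4 * (c0S * W + 1) := by positivity
      rw [div_mul_eq_mul_div, div_le_div_iff₀ hden (by norm_num : (0 : ℝ) < 4)]
      have e1 : cS * (s * c0S * W) * 4 = s * cS * (4 * (c0S * W + 1)) - 4 * (s * cS) := by ring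
      rw [e1]
      have h4 : 0 ≤ 4 * (s * cS) := by positivity
      linarith only [h4]
    linarith only [h2, h3, hγco]
  have hmain := decay241_flat hj (fun y => h (cornerIter k y)) (mul_nonneg hs0.le hgk0) (mul_nonneg hs0.le hκ'.le)
    (by rw [← hcv]; exact hElt) h238 hcΔ0 hδ₀' hker hθS0.le hθ4 (by rw [← hct, ← hcv]; exact hsmall) x₁ x₂
  rw [← hcv] at hmain
  refine hmain.trans ?_
  have he0 : 0 ≤ Real.exp (-(θS * B5Ineq137Torus.T P (0 + k) x₁ x₂)) := (Real.exp_pos _).le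
  refine mul_le_mul_of_nonneg_right ?_ he0
  calc 4 / (cv - E) ≤ 4 / (s * cS / 2) := div_le_div_of_nonneg_left (by norm_num) (by positivity) hγco
    _ = s⁻¹ * (8 / cS) := by field_simp; ring

/-- **(2.41) VERBATIM SHAPE** `|C^{(k)}_Λ(u; x₁, x₂)| ≦ ce^{−c|x₁−x₂|}` at every flat / pure-gauge `u = 1^h` for gen 15's `Δ_{k,loc}(1^h)`: the bound of
`decay241_deltaLocT_flat` with the factor `(A/a_k)^{−1} ≤ 1` dropped (`one_le_ratio`) — `‖C^{(k)}_Λ(1^h; x₁, x₂)‖ ≤ c₂·e^{−δ₁|x₁−x₂|_{T^{(k)}}}` with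
`(δ₁, c₂)` depending on `(d, L, a, m, κ̂)` only (two constants for the print's generic `c`, cf. HOME/GAPS.md G-C2-p02-02), same hypotheses.
[cite: BalabanImbrieJaffe1988, (2.41) p.264] -/
theorem decay241_deltaLocT_flat_printed (d ℓ : ℕ) (hℓ : 1 ≤ ℓ) {a : ℝ} (ha : 0 < a) (m : ℕ) {κ' : ℝ} (hκ' : 0 < κ') :
    ∃ δ₀ c₁ δ₁ c₂ : ℝ, 0 < δ₀ ∧ 0 < c₁ ∧ 0 < δ₁ ∧ 0 < c₂ ∧ ∀ (P : Params) (hPd : P.d = d + 1), P.L = ℓ + 1 →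
      ∀ k : ℕ, 1 ≤ k → k ≤ P.K → k + 1 ≤ P.m + P.K → ∀ (c M0 : Fin (d + 1) → ℕ), (∀ i, 1 ≤ M0 i) →
        (∀ i, c i * P.L ^ k + P.L ^ k * M0 i ≤ P.sitesPerDir 0) → (∀ i, P.L ^ k * M0 i < P.sitesPerDir 0) →
      ∀ (ι : Type) [Fintype ι] (cube : ι → Finset (Balaban1983to89.Site P 0))
        (lam : ι → Balaban1983to89.Site P 0 → Balaban1983to89.Site P 0 → ℝ)
        (ζ'' : Balaban1983to89.Site P 0 → Balaban1983to89.Site P 0 → ℝ),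
        (∀ α, ∃ t M : Fin (d + 1) → ℕ, (∀ i, 1 ≤ M i) ∧ (∀ i, t i + M i ≤ M0 i) ∧
            cube α = cubeT hPd (P.L ^ k) (c + t) fun i => P.L ^ k * M i) →
        (∀ x y, ∑ α, |lam α x y| ≤ 1) → (∀ x y, 0 ≤ ζ'' x y ∧ ζ'' x y ≤ 1) →
      ∀ (h : GaugeTransf P 0 U1) (R R₁ : ℝ), 0 ≤ R → 0 ≤ R₁ → ∀ (Λ : Finset (Balaban1983to89.Site P (0 + k))),
        IsBlockUnion 1 Λ →
        (∀ y₁ ∈ Λ,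
          (∀ x ∈ blockK k y₁, ∀ y, ζ'' x y ≠ 0 → ∑ α, lam α x y = 1) ∧
          (∀ x ∈ blockK k y₁, ∀ α y, ζ'' x y * lam α x y ≠ 0 → x ∈ cube α ∧ y ∈ cube α ∧
              ∀ w ∈ cubeT hPd (P.L ^ k) c (fun i => P.L ^ k * M0 i), w ∉ cube α →
                R ≤ B5Ineq137Torus.T P 0 x w ∧ R ≤ B5Ineq137Torus.T P 0 y w) ∧
          (∀ x ∈ blockK k y₁, ∀ y, B5Ineq137Torus.T P 0 x y ≤ R₁ → ζ'' x y = 1) ∧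
          ∃ S : Finset ι, S.card ≤ m ∧ ∀ x ∈ blockK k y₁, ∀ α y, ζ'' x y * lam α x y ≠ 0 → α ∈ S) →
        (∀ b : PBond P (0 + k), (b.src ∈ Λ ∨ b.tgt ∈ Λ) →
          b ∈ starB (innerK k (cubeT hPd (P.L ^ k) c fun i => P.L ^ k * M0 i))) →
        (B1RG242Torus.α P a k * (P.L : ℝ) ^ (k * P.d)) / B1.aSeq a P.L k *
            (B1.aSeq a P.L k ^ 2 * c₁ *
              ((m : ℝ) * Real.exp (-(δ₀ * (((P.L : ℝ) ^ k)⁻¹ * (2 * R)))) + Real.exp (-(δ₀ / 2 * (((P.L : ℝ) ^ k)⁻¹ * R₁))))) ≤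
          1 / 2 * c240 P ((B1RG242Torus.α P a k * (P.L : ℝ) ^ (k * P.d)) / B1.aSeq a P.L k * min (B1.aSeq a P.L k / (8 * P.d)) (1 / 2))
            ((B1RG242Torus.α P a k * (P.L : ℝ) ^ (k * P.d)) / B1.aSeq a P.L k * κ') →
      ∀ x₁ x₂ : ↥Λ,
        ‖(compress Λ (op240 (deltaLocT (B1RG242Torus.α P a k * (P.L : ℝ) ^ (k * P.d)) P.eps⁻¹ (gaugeAct h (1 : GaugeField P 0 U1)) k
            cube lam ζ'') ((B1RG242Torus.α P a k * (P.L : ℝ) ^ (k * P.d)) / B1.aSeq a P.L k * κ')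
            (gaugeAct (fun y => h (cornerIter k y)) (1 : GaugeField P (0 + k) U1))))⁻¹ x₁ x₂‖ ≤
          c₂ * Real.exp (-(δ₁ * B5Ineq137Torus.T P (0 + k) x₁ x₂)) := by
  obtain ⟨δ₀, c₁, δ₁, c₂, hδ₀, hc₁, hδ₁, hc₂, H⟩ := decay241_deltaLocT_flat d ℓ hℓ ha m hκ'
  refine ⟨δ₀, c₁, δ₁, c₂, hδ₀, hc₁, hδ₁, hc₂, ?_⟩
  intro P hPd hPL k hk1 hkK hk' c M0 hM0 hfit0 hN0 ι _ cube lam ζ hcube hlam hζ h R R₁ hR hR₁ Λ hΛ hrows hbonds hmargin x₁ x₂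
  refine (H P hPd hPL k hk1 hkK hk' c M0 hM0 hfit0 hN0 ι cube lam ζ hcube hlam hζ h R R₁ hR hR₁ Λ hΛ hrows hbonds hmargin x₁ x₂).trans ?_
  have hs : (B1RG242Torus.α P a k * (P.L : ℝ) ^ (k * P.d) / B1.aSeq a P.L k)⁻¹ ≤ 1 :=
    inv_le_one_of_one_le₀ (one_le_ratio P ha hk1 hkK)
  have he : 0 ≤ Real.exp (-(δ₁ * B5Ineq137Torus.T P (0 + k) x₁ x₂)) := (Real.exp_pos _).le
  calc (B1RG242Torus.α P a k * (P.L : ℝ) ^ (k * P.d) / B1.aSeq a P.L k)⁻¹ * c₂ * Real.exp (-(δ₁ * B5Ineq137Torus.T P (0 + k) x₁ x₂))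
      ≤ 1 * c₂ * Real.exp (-(δ₁ * B5Ineq137Torus.T P (0 + k) x₁ x₂)) :=
        mul_le_mul_of_nonneg_right (mul_le_mul_of_nonneg_right hs hc₂.le) he
    _ = c₂ * Real.exp (-(δ₁ * B5Ineq137Torus.T P (0 + k) x₁ x₂)) := by ring

end Concrete

end

end Literature.MathematicalPhysics.QuantumFieldTheory.BalabanImbrieJaffe1984to88.BIJ88Decay241FlatTorus
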